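import Mathlib
import Summits.MatrixMultiplication.MatrixMultiplication.Theorems.AutomaticSTPPDesignsAutomaticPackingThesisCyclicCalibration
import Summits.MatrixMultiplication.MatrixMultiplication.Theorems.AutomaticSTPPDesignsAutomaticPackingThesisUniformNormalForm

/-!
# `AutomaticPackingThesis` — calibration rung `τ ≥ 0.94` (the optimal two-triple CRT design)

Route `MatrixMultiplication/AutomaticSTPPDesigns`, crux `stmt-MatrixMultiplication-7356`
(`AutomaticPackingThesis`), line `Sketch`, registered stub `stub_cyclicBeat_of_ge094` (lead c2,
cycle 3). Support file: it lowers the theorem-level rung of the crux's normal form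
(`stub_cyclicBeat`: `∀ τ > 2/3 …`) from `τ ≥ 19/20` (`…CyclicCalibration.lean`, moduli `19, 20, 21`)
to `τ ≥ 47/50`, using the SAME construction (`exists_rotationPair_zmod`: the CKSU 2005 Prop. 5.2
two-triple design over pairwise coprime moduli, transported to the cyclic group by the Chinese
remainder theorem) at its optimal moduli `15, 16, 17`: host `ℤ/4080`, two triples of mass
`14·15·16 = 3360`, exact threshold `log 2040 / log 3360 ≈ 0.93855` (a scan over all pairwise
coprime triples below `60` shows no two-triple CRT design does better). Consequently any uniform
packing ceiling refuting the crux (`not_automaticPackingThesis_iff_uniformGap`) has `τ₀ < 0.94`, and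
(uniform normal form, `uniformBeat_of_cyclicBeat`) uniform witnesses exist at every `τ ≥ 0.94`.

## References

* H. Cohn, R. Kleinberg, B. Szegedy, C. Umans, *Group-theoretic algorithms for matrix
  multiplication*, FOCS 2005, arXiv:math/0511460, Prop. 5.2 / §5 (the two-triple design),
  Lemma 5.4, Thm. 5.5.
-/

-- single-conjunct summit: the mandated namespace repeats `MatrixMultiplication`.
set_option linter.dupNamespace false

noncomputable section

namespace Summit.MatrixMultiplication.MatrixMultiplication.Theorems

namespace AutomaticPackingThesis

open Finset Literature.Combinatorics.Additive Literature.Computability.AlgebraicComplexity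

/-- `3360^(47/50) > 2040`, i.e. `2040^50 < 3360^47`. [folklore] -/
theorem rpow_bound_3360 : (2040 : ℝ) < (3360 : ℝ) ^ ((47 : ℝ) / 50) := by
  have h50 : (0 : ℝ) < 1 / 50 := by norm_num
  have hnat : (2040 : ℝ) ^ (50 : ℕ) < (3360 : ℝ) ^ (47 : ℕ) := by norm_num
  have h1 : (2040 : ℝ) = ((2040 : ℝ) ^ (50 : ℕ)) ^ ((1 : ℝ) / 50) := by
    rw [← Real.rpow_natCast, ← Real.rpow_mul (by norm_num)]
    norm_num
  have h2 : (3360 : ℝ) ^ ((47 : ℝ) / 50) = ((3360 : ℝ) ^ (47 : ℕ)) ^ ((1 : ℝ) / 50) := by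
    rw [← Real.rpow_natCast, ← Real.rpow_mul (by norm_num)]
    norm_num
  rw [h1, h2]
  exact Real.rpow_lt_rpow (by positivity) hnat h50

/-- **A cyclic design beating its host at every exponent `τ ≥ 0.94`** (any-modulus form): the
cyclic group `ℤ/4080` hosts an STPP pair (the CKSU two-triple design over the coprime moduli
`15, 16, 17`) of masses `14·15·16 = 3360` twice, and `2·3360^τ ≥ 2·3360^{47/50} > 4080`.
[cite: CohnKleinbergSzegedyUmans2005, §5] -/
theorem cyclicBeat_anyModulus_of_ge094 (τ : ℝ) (hτ : (47 : ℝ) / 50 ≤ τ) :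
    ∃ (N n : ℕ) (_ : 2 ≤ N) (A B C : Fin n → Finset (ZMod N)),
      IsSTPP A B C ∧ (N : ℝ) < ∑ i, (((A i).card * (B i).card * (C i).card : ℕ) : ℝ) ^ τ := by
  haveI : NeZero (15 : ℕ) := ⟨by norm_num⟩
  haveI : NeZero (16 : ℕ) := ⟨by norm_num⟩
  haveI : NeZero (17 : ℕ) := ⟨by norm_num⟩
  obtain ⟨A, B, C, hS, hA0, hB0, hC0, hA1, hB1, hC1⟩ :=
    exists_rotationPair_zmod 15 16 17 (by norm_num) (by norm_num)
  refine ⟨15 * (16 * 17), 2, by norm_num, A, B, C, hS, ?_⟩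
  rw [Fin.sum_univ_two, hA0, hB0, hC0, hA1, hB1, hC1]
  push_cast
  have hone : (1 : ℝ) ≤ 3360 := by norm_num
  have hmono : (3360 : ℝ) ^ ((47 : ℝ) / 50) ≤ (3360 : ℝ) ^ τ :=
    Real.rpow_le_rpow_of_exponent_le hone hτ
  have key := rpow_bound_3360
  linarith

/-- **The normal form of the crux holds at every exponent `τ ≥ 0.94`**, in the exact shape of the
registered stub `stub_cyclicBeat` (`p = 4080`, `K = 1`). [cite: CohnKleinbergSzegedyUmans2005, §5] -/
theorem cyclicBeat_of_ge094 (τ : ℝ) (hτ : (47 : ℝ) / 50 ≤ τ) :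
    ∃ (p K n : ℕ) (_ : 2 ≤ p) (A B C : Fin n → Finset (ZMod (p ^ K))),
      IsSTPP A B C ∧ (p : ℝ) ^ K < ∑ i, (((A i).card * (B i).card * (C i).card : ℕ) : ℝ) ^ τ := by
  obtain ⟨N, n, hN, A, B, C, hS, hbeat⟩ := cyclicBeat_anyModulus_of_ge094 τ hτ
  obtain ⟨A', B', C', hS', hcard⟩ := isSTPP_transport_eq (pow_one N).symm hS
  refine ⟨N, 1, n, hN, A', B', C', hS', ?_⟩
  have hsum : ∑ i, (((A' i).card * (B' i).card * (C' i).card : ℕ) : ℝ) ^ τ =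
      ∑ i, (((A i).card * (B i).card * (C i).card : ℕ) : ℝ) ^ τ :=
    Finset.sum_congr rfl fun i _ => by rw [(hcard i).1, (hcard i).2.1, (hcard i).2.2]
  rw [hsum]
  push_cast
  simpa using hbeat

/-- **No uniform packing ceiling at `τ₀ ≥ 0.94`.** The refutation normal form of the crux can only
hold with `τ₀ < 47/50`. [folklore] -/
theorem not_uniformGap_of_ge094 (τ₀ : ℝ) (hτ₀ : (47 : ℝ) / 50 ≤ τ₀) :
    ¬ ∀ (N n : ℕ), 2 ≤ N → ∀ (A B C : Fin n → Finset (ZMod N)),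
      IsSTPP A B C → ∑ i, (((A i).card * (B i).card * (C i).card : ℕ) : ℝ) ^ τ₀ ≤ (N : ℝ) := by
  intro h
  obtain ⟨N, n, hN, A, B, C, hS, hbeat⟩ := cyclicBeat_anyModulus_of_ge094 τ₀ hτ₀
  exact absurd (hbeat.trans_le (h N n hN A B C hS)) (lt_irrefl _)

/-- **Uniform witnesses at every `τ ≥ 0.94`**: by the uniform normal form
(`uniformBeat_of_cyclicBeat`), some cyclic `p`-group hosts an STPP design with all blocks of one
size `M ≥ 2` and `p^K < n (M³)^τ`. [folklore] -/
theorem uniformBeat_of_ge094 (τ : ℝ) (hτ : (47 : ℝ) / 50 ≤ τ) :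
    ∃ (p K n M : ℕ) (_ : 2 ≤ p) (_ : 2 ≤ M) (A B C : Fin n → Finset (ZMod (p ^ K))),
      IsSTPP A B C ∧ (∀ i, (A i).card = M ∧ (B i).card = M ∧ (C i).card = M) ∧
        (p : ℝ) ^ K < n * ((M : ℝ) ^ 3) ^ τ :=
  uniformBeat_of_cyclicBeat (by linarith) (cyclicBeat_of_ge094 τ hτ)

/-- Registered stub `stub_cyclicBeat_of_ge094` of crux stmt-MatrixMultiplication-7356 (line `Sketch`,
calibration of the load-bearing stub `stub_cyclicBeat`): its statement holds for every `τ ≥ 47/50`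
— verbatim `cyclicBeat_of_ge094`. [folklore] -/
theorem stub_cyclicBeat_of_ge094 : ∀ τ : ℝ, (47 : ℝ) / 50 ≤ τ →
    ∃ (p K n : ℕ) (_ : 2 ≤ p) (A B C : Fin n → Finset (ZMod (p ^ K))),
      Literature.Computability.AlgebraicComplexity.IsSTPP A B C ∧
        (p : ℝ) ^ K < ∑ i, (((A i).card * (B i).card * (C i).card : ℕ) : ℝ) ^ τ :=
  cyclicBeat_of_ge094

end AutomaticPackingThesis

end Summit.MatrixMultiplication.MatrixMultiplication.Theorems

end
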